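import Mathlib

/-!
# `NewtonUnitEquationsNewtonTauWeakResidueNormalForm` — exchange normal form of a residue-constrained maximiser

Rung toward THEOREM G of line `binomial-normal-form` (crux `NewtonTauWeak`, stmt-ValiantsHypothesis-5904, lead c5):
registered stub `stub_residueNormalForm`.

Setting.  Indices `j : Fin N` carry nonzero real values `c j` and blocks `B j : Fin s`; block `i` carries a modulus
`q i ≥ 1` and a residue `r i`.  `J` is *admissible* if `|J ∩ B⁻¹ i| ≡ r i (mod q i)` for every `i`.
Claim: if an admissible `J` maximises `Σ_{j ∈ J} c j` among admissible sets, then for some `a i, b i < q i` the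
CANONICAL set `Jcan(a, b)` = (positives `j`, `c j > 0`, of in-block rank `≥ b (B j)` for the key `(c j, j)`) ∪
(negatives `j`, `c j < 0`, of in-block rank `< a (B j)` for the key `(-c j, j)`) — all positives of block `i` but its
`b i` cheapest, plus its `a i` negatives closest to `0` — is admissible with the same value as `J`.

Proof (exchange argument).  `P i` / `M i` := positives / negatives of block `i` (by `c j ≠ 0` they partition the
block), `b i := |P i \ J|`, `a i := |M i ∩ J|`.  (1) `b i < q i`: otherwise add `q i` elements of `P i \ J` to `J` —
admissible, strictly better; dually `a i < q i` (remove `q i` elements of `M i ∩ J`).  (2) The rank on a finite set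
`S` is a bijection onto `{0, …, |S| - 1}` (`ResidueNormalFormAux.card_filter_rank_lt`), so `Jcan ∩ block i` has
`(|P i| - b i) + a i = |J ∩ block i|` elements: `Jcan` is admissible, so `Σ_{Jcan} c ≤ Σ_J c`.  (3) The `b i` positives
of least rank are a down-set for the key, so their sum is least among `b i`-subsets of `P i`
(`ResidueNormalFormAux.sum_filter_rank_lt_le`), in particular `≤ Σ_{P i \ J} c`; dually for the `a i` top
negatives.  Summing over blocks, `Σ_J c ≤ Σ_{Jcan} c`.  [folklore: exchange argument]
-/

set_option linter.dupNamespace false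

noncomputable section

open scoped BigOperators

namespace Summit.ValiantsHypothesis.ValiantsHypothesis.Theorems.NewtonUnitEquationsNewtonTauWeak

namespace ResidueNormalFormAux

variable {N : ℕ}

/-- The lexicographic key `(c x, x)` is total: two distinct indices compare one way or the other. [folklore] -/
theorem key_total (c : Fin N → ℝ) {x y : Fin N} (hxy : x ≠ y) :
    (c x < c y ∨ (c x = c y ∧ x < y)) ∨ (c y < c x ∨ (c y = c x ∧ y < x)) := by
  rcases lt_trichotomy (c x) (c y) with h | h | h
  · exact Or.inl (Or.inl h)
  · rcases lt_or_gt_of_ne hxy with h' | h'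
    · exact Or.inl (Or.inr ⟨h, h'⟩)
    · exact Or.inr (Or.inr ⟨h.symm, h'⟩)
  · exact Or.inr (Or.inl h)

/-- The lexicographic key order is irreflexive. [folklore] -/
theorem key_irrefl (c : Fin N → ℝ) (x : Fin N) : ¬ (c x < c x ∨ (c x = c x ∧ x < x)) := by
  rintro (h | ⟨-, h⟩) <;> exact lt_irrefl _ h

/-- The lexicographic key order is transitive. [folklore] -/
theorem key_trans (c : Fin N → ℝ) {x y z : Fin N} (hxy : c x < c y ∨ (c x = c y ∧ x < y))
    (hyz : c y < c z ∨ (c y = c z ∧ y < z)) : c x < c z ∨ (c x = c z ∧ x < z) := by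
  rcases hxy with h | ⟨h, h'⟩ <;> rcases hyz with g | ⟨g, g'⟩
  · exact Or.inl (h.trans g)
  · exact Or.inl (lt_of_lt_of_le h g.le)
  · exact Or.inl (lt_of_le_of_lt h.le g)
  · exact Or.inr ⟨h.trans g, h'.trans g'⟩

/-- A smaller key has a value at most as large. [folklore] -/
theorem key_le (c : Fin N → ℝ) {x y : Fin N} (h : c x < c y ∨ (c x = c y ∧ x < y)) : c x ≤ c y := by
  rcases h with h | ⟨h, -⟩ <;> exact h.le

/-- The rank `#{z ∈ S | key z < key x}` is strictly monotone in the key on `S`. [folklore] -/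
theorem rank_lt_rank (S : Finset (Fin N)) (c : Fin N → ℝ) {x y : Fin N} (hx : x ∈ S)
    (hxy : c x < c y ∨ (c x = c y ∧ x < y)) :
    (S.filter fun z => c z < c x ∨ (c z = c x ∧ z < x)).card <
      (S.filter fun z => c z < c y ∨ (c z = c y ∧ z < y)).card := by
  refine Finset.card_lt_card ⟨fun z hz => ?_, fun hsub => ?_⟩
  · rw [Finset.mem_filter] at hz ⊢
    exact ⟨hz.1, key_trans c hz.2 hxy⟩
  · exact key_irrefl c x (Finset.mem_filter.1 (hsub (Finset.mem_filter.2 ⟨hx, hxy⟩))).2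

/-- The rank of an element of `S` is `< |S|`. [folklore] -/
theorem rank_lt_card (S : Finset (Fin N)) (c : Fin N → ℝ) {x : Fin N} (hx : x ∈ S) :
    (S.filter fun z => c z < c x ∨ (c z = c x ∧ z < x)).card < S.card :=
  Finset.card_lt_card (Finset.filter_ssubset.2 ⟨x, hx, key_irrefl c x⟩)

/-- The rank is injective on `S`. [folklore] -/
theorem rank_injOn (S : Finset (Fin N)) (c : Fin N → ℝ) :
    Set.InjOn (fun x => (S.filter fun z => c z < c x ∨ (c z = c x ∧ z < x)).card) S := by
  intro x hx y hy hxy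
  by_contra hne
  rcases key_total c hne with h | h
  · exact absurd hxy (ne_of_lt (rank_lt_rank S c hx h))
  · exact absurd hxy (ne_of_gt (rank_lt_rank S c hy h))

/-- The rank maps `S` onto `{0, …, |S| - 1}`. [folklore] -/
theorem image_rank (S : Finset (Fin N)) (c : Fin N → ℝ) :
    S.image (fun x => (S.filter fun z => c z < c x ∨ (c z = c x ∧ z < x)).card) = Finset.range S.card := by
  apply Finset.eq_of_subset_of_card_le
  · intro m hm
    obtain ⟨x, hx, rfl⟩ := Finset.mem_image.1 hm
    exact Finset.mem_range.2 (rank_lt_card S c hx)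
  · rw [Finset.card_range, Finset.card_image_of_injOn (rank_injOn S c)]

/-- Exactly `n` elements of `S` have rank `< n` (for `n ≤ |S|`). [folklore] -/
theorem card_filter_rank_lt (S : Finset (Fin N)) (c : Fin N → ℝ) {n : ℕ} (hn : n ≤ S.card) :
    (S.filter fun x => (S.filter fun z => c z < c x ∨ (c z = c x ∧ z < x)).card < n).card = n := by
  have himg : (S.filter fun x => (S.filter fun z => c z < c x ∨ (c z = c x ∧ z < x)).card < n).image
      (fun x => (S.filter fun z => c z < c x ∨ (c z = c x ∧ z < x)).card) = Finset.range n := by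
    ext m
    simp only [Finset.mem_image, Finset.mem_filter, Finset.mem_range]
    refine ⟨?_, fun hm => ?_⟩
    · rintro ⟨x, ⟨-, hxn⟩, rfl⟩
      exact hxn
    · have hm' : m ∈ S.image (fun x => (S.filter fun z => c z < c x ∨ (c z = c x ∧ z < x)).card) := by
        rw [image_rank]
        exact Finset.mem_range.2 (lt_of_lt_of_le hm hn)
      obtain ⟨x, hx, rfl⟩ := Finset.mem_image.1 hm'
      exact ⟨x, ⟨hx, hm⟩, rfl⟩
  rw [← Finset.card_image_of_injOn ((rank_injOn S c).mono (Finset.coe_subset.2 (Finset.filter_subset _ S))),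
    himg, Finset.card_range]

/-- **Down-sets are cheapest.**  If every element of `S` outside `D` is worth at least every element of `D`, then
`D` has the least total value among the subsets of `S` of its size. [folklore] -/
theorem sum_down_le (S D E : Finset (Fin N)) (c : Fin N → ℝ) (hE : E ⊆ S) (hcard : D.card = E.card)
    (hdown : ∀ x ∈ D, ∀ y ∈ S, y ∉ D → c x ≤ c y) : ∑ x ∈ D, c x ≤ ∑ x ∈ E, c x := by
  have hcard' : (D \ E).card = (E \ D).card := by
    have h1 := Finset.card_sdiff_add_card_inter D E
    have h2 := Finset.card_sdiff_add_card_inter E D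
    rw [Finset.inter_comm] at h2
    omega
  have hkey : ∑ x ∈ D \ E, c x ≤ ∑ x ∈ E \ D, c x := by
    rcases (D \ E).eq_empty_or_nonempty with h0 | hne
    · have h0' : E \ D = ∅ := by rw [← Finset.card_eq_zero, ← hcard', h0, Finset.card_empty]
      rw [h0, h0']
    · obtain ⟨x₀, hx₀, hmax⟩ := Finset.exists_max_image (D \ E) c hne
      have hx₀D : x₀ ∈ D := (Finset.mem_sdiff.1 hx₀).1
      calc ∑ x ∈ D \ E, c x ≤ (D \ E).card • c x₀ := Finset.sum_le_card_nsmul _ _ _ hmax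
        _ = (E \ D).card • c x₀ := by rw [hcard']
        _ ≤ ∑ x ∈ E \ D, c x := Finset.card_nsmul_le_sum _ _ _ fun y hy =>
            hdown x₀ hx₀D y (hE (Finset.mem_sdiff.1 hy).1) (Finset.mem_sdiff.1 hy).2
  have hD := Finset.sum_inter_add_sum_sdiff D E c
  have hE' := Finset.sum_inter_add_sum_sdiff E D c
  rw [Finset.inter_comm] at hE'
  linarith

/-- The `|E|` elements of `S` of least rank have total value `≤ Σ_E c` for every `E ⊆ S` (they form a down-set for
the key). [folklore] -/
theorem sum_filter_rank_lt_le (S : Finset (Fin N)) (c : Fin N → ℝ) {E : Finset (Fin N)} (hE : E ⊆ S) :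
    ∑ x ∈ S.filter (fun x => (S.filter fun z => c z < c x ∨ (c z = c x ∧ z < x)).card < E.card), c x ≤
      ∑ x ∈ E, c x := by
  refine sum_down_le S _ E c hE (card_filter_rank_lt S c (Finset.card_le_card hE)) fun x hx y hy hyD => ?_
  have hne : x ≠ y := by
    rintro rfl
    exact hyD hx
  rcases key_total c hne with h | h
  · exact key_le c h
  · exact absurd (Finset.mem_filter.2 ⟨hy, (rank_lt_rank S c hy h).trans (Finset.mem_filter.1 hx).2⟩) hyD

/-- **Exchange normal form, abstract ranks.**  The statement of `stub_residueNormalForm` with the two in-block rank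
functions `rk` (positives, key `(c j, j)`) and `rko` (negatives, key `(-c j, j)`) abstracted into parameters
characterised by `hrk`, `hrko`. [folklore: exchange argument] -/
theorem normalForm_of_rank (N s : ℕ) (B : Fin N → Fin s) (q r : Fin s → ℕ) (hq : ∀ i, 1 ≤ q i)
    (c : Fin N → ℝ) (hc : ∀ j, c j ≠ 0) (J : Finset (Fin N))
    (hJ : ∀ i, (J.filter fun j => B j = i).card % q i = r i % q i)
    (hmax : ∀ J' : Finset (Fin N), (∀ i, (J'.filter fun j => B j = i).card % q i = r i % q i) →
      ∑ j ∈ J', c j ≤ ∑ j ∈ J, c j)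
    (rk rko : Fin N → ℕ)
    (hrk : ∀ j, rk j = ((Finset.univ.filter fun z : Fin N => B z = B j ∧ 0 < c z).filter
        fun z => c z < c j ∨ (c z = c j ∧ z < j)).card)
    (hrko : ∀ j, rko j = ((Finset.univ.filter fun z : Fin N => B z = B j ∧ c z < 0).filter
        fun z => -c z < -c j ∨ (-c z = -c j ∧ z < j)).card) :
    ∃ a b : Fin s → ℕ, (∀ i, a i < q i ∧ b i < q i) ∧
      (∀ i, ((Finset.univ.filter fun j : Fin N =>
          (0 < c j ∧ b (B j) ≤ rk j) ∨ (c j < 0 ∧ rko j < a (B j))).filter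
            fun j => B j = i).card % q i = r i % q i) ∧
      ∑ j ∈ (Finset.univ.filter fun j : Fin N =>
          (0 < c j ∧ b (B j) ≤ rk j) ∨ (c j < 0 ∧ rko j < a (B j))), c j = ∑ j ∈ J, c j := by
  -- the blocks, split by sign
  obtain ⟨P, hP⟩ : ∃ P : Fin s → Finset (Fin N),
      ∀ i, P i = Finset.univ.filter fun z : Fin N => B z = i ∧ 0 < c z := ⟨_, fun _ => rfl⟩
  obtain ⟨M, hM⟩ : ∃ M : Fin s → Finset (Fin N),
      ∀ i, M i = Finset.univ.filter fun z : Fin N => B z = i ∧ c z < 0 := ⟨_, fun _ => rfl⟩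
  have memP : ∀ i j, j ∈ P i ↔ B j = i ∧ 0 < c j := fun i j => by rw [hP]; simp
  have memM : ∀ i j, j ∈ M i ↔ B j = i ∧ c j < 0 := fun i j => by rw [hM]; simp
  have hrk' : ∀ j, rk j = ((P (B j)).filter fun z => c z < c j ∨ (c z = c j ∧ z < j)).card := fun j => by
    rw [hrk, hP]
  have hrko' : ∀ j, rko j = ((M (B j)).filter fun z => -c z < -c j ∨ (-c z = -c j ∧ z < j)).card := fun j => by
    rw [hrko, hM]
  have hPM : ∀ i, Disjoint (P i) (M i) := fun i =>
    Finset.disjoint_left.2 fun x hxP hxM => lt_asymm ((memP i x).1 hxP).2 ((memM i x).1 hxM).2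
  -- the parameters `a i = |M i ∩ J|`, `b i = |P i \ J|`
  obtain ⟨a, ha⟩ : ∃ a : Fin s → ℕ, ∀ i, a i = (M i ∩ J).card := ⟨_, fun _ => rfl⟩
  obtain ⟨b, hb⟩ : ∃ b : Fin s → ℕ, ∀ i, b i = (P i \ J).card := ⟨_, fun _ => rfl⟩
  -- (1) `b i < q i`: otherwise add `q i` omitted positives of block `i`
  have hb_lt : ∀ i, b i < q i := by
    intro i
    by_contra hge
    rw [not_lt, hb] at hge
    obtain ⟨E, hEsub, hEcard⟩ := Finset.exists_subset_card_eq hge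
    have hEP : ∀ x ∈ E, B x = i ∧ 0 < c x := fun x hx => (memP i x).1 (Finset.mem_sdiff.1 (hEsub hx)).1
    have hJE : Disjoint J E := Finset.disjoint_left.2 fun x hxJ hxE => (Finset.mem_sdiff.1 (hEsub hxE)).2 hxJ
    have hadm : ∀ i', ((J ∪ E).filter fun j => B j = i').card % q i' = r i' % q i' := by
      intro i'
      rw [Finset.filter_union, Finset.card_union_of_disjoint (Finset.disjoint_filter_filter hJE)]
      by_cases hi : i' = i
      · rw [Finset.filter_true_of_mem (s := E) fun x hx => (hEP x hx).1.trans hi.symm, hEcard, hi,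
          Nat.add_mod_right]
        exact hJ i
      · rw [Finset.filter_false_of_mem (s := E) fun x hx h => hi (h.symm.trans (hEP x hx).1),
          Finset.card_empty, Nat.add_zero]
        exact hJ i'
    have hle := hmax _ hadm
    rw [Finset.sum_union hJE] at hle
    have hpos : 0 < ∑ j ∈ E, c j :=
      Finset.sum_pos (fun x hx => (hEP x hx).2) (Finset.card_pos.1 (by rw [hEcard]; exact hq i))
    linarith
  -- (1') `a i < q i`: otherwise remove `q i` chosen negatives of block `i`
  have ha_lt : ∀ i, a i < q i := by
    intro i
    by_contra hge
    rw [not_lt, ha] at hge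
    obtain ⟨E, hEsub, hEcard⟩ := Finset.exists_subset_card_eq hge
    have hEM : ∀ x ∈ E, B x = i ∧ c x < 0 := fun x hx => (memM i x).1 (Finset.mem_inter.1 (hEsub hx)).1
    have hEJ : E ⊆ J := fun x hx => (Finset.mem_inter.1 (hEsub hx)).2
    have hsplit : ∀ i', (J.filter fun j => B j = i').card =
        ((J \ E).filter fun j => B j = i').card + (E.filter fun j => B j = i').card := by
      intro i'
      rw [← Finset.card_union_of_disjoint (Finset.disjoint_filter_filter Finset.sdiff_disjoint),
        ← Finset.filter_union, Finset.sdiff_union_of_subset hEJ]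
    have hadm : ∀ i', ((J \ E).filter fun j => B j = i').card % q i' = r i' % q i' := by
      intro i'
      have h1 := hJ i'
      rw [hsplit i'] at h1
      by_cases hi : i' = i
      · rw [Finset.filter_true_of_mem (s := E) fun x hx => (hEM x hx).1.trans hi.symm, hEcard, hi,
          Nat.add_mod_right] at h1
        rw [hi]
        exact h1
      · rw [Finset.filter_false_of_mem (s := E) fun x hx h => hi (h.symm.trans (hEM x hx).1),
          Finset.card_empty, Nat.add_zero] at h1
        exact h1
    have hle := hmax _ hadm
    have hneg : ∑ j ∈ E, c j < 0 :=
      Finset.sum_neg (fun x hx => (hEM x hx).2) (Finset.card_pos.1 (by rw [hEcard]; exact hq i))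
    have hsd := Finset.sum_sdiff (f := c) hEJ
    linarith
  -- (2) cardinalities of the canonical pieces
  have hbP : ∀ i, b i ≤ (P i).card := fun i => by rw [hb]; exact Finset.card_le_card Finset.sdiff_subset
  have haM : ∀ i, a i ≤ (M i).card := fun i => by rw [ha]; exact Finset.card_le_card Finset.inter_subset_left
  have hDcard : ∀ i, ((P i).filter fun x =>
      ((P i).filter fun z => c z < c x ∨ (c z = c x ∧ z < x)).card < b i).card = b i :=
    fun i => card_filter_rank_lt (P i) c (hbP i)
  have hUcard : ∀ i, ((M i).filter fun x =>
      ((M i).filter fun z => -c z < -c x ∨ (-c z = -c x ∧ z < x)).card < a i).card = a i :=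
    fun i => card_filter_rank_lt (M i) (fun j => -c j) (haM i)
  have hKPcard : ∀ i, ((P i).filter fun x =>
      ¬ ((P i).filter fun z => c z < c x ∨ (c z = c x ∧ z < x)).card < b i).card = (P i).card - b i := by
    intro i
    have h : ((P i).filter fun x => ((P i).filter fun z => c z < c x ∨ (c z = c x ∧ z < x)).card < b i).card +
        ((P i).filter fun x => ¬ ((P i).filter fun z => c z < c x ∨ (c z = c x ∧ z < x)).card < b i).card =
          (P i).card :=
      Finset.card_filter_add_card_filter_not _
    rw [hDcard i] at h
    omega
  -- (3) the canonical set, through its membership predicate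
  suffices H : ∀ K : Finset (Fin N), (∀ j, j ∈ K ↔ (0 < c j ∧ b (B j) ≤ rk j) ∨ (c j < 0 ∧ rko j < a (B j))) →
      (∀ i, (K.filter fun j => B j = i).card % q i = r i % q i) ∧ ∑ j ∈ K, c j = ∑ j ∈ J, c j by
    refine ⟨a, b, fun i => ⟨ha_lt i, hb_lt i⟩, ?_⟩
    exact H _ (fun j => by simp)
  intro K memK
  -- block `i` of `K`: kept positives and added negatives
  have hKB : ∀ i, K.filter (fun j => B j = i) =
      ((P i).filter fun x => ¬ ((P i).filter fun z => c z < c x ∨ (c z = c x ∧ z < x)).card < b i) ∪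
      ((M i).filter fun x => ((M i).filter fun z => -c z < -c x ∨ (-c z = -c x ∧ z < x)).card < a i) := by
    intro i
    ext j
    simp only [Finset.mem_filter, Finset.mem_union, memK, memP, memM]
    constructor
    · rintro ⟨h | h, hji⟩
      · subst hji
        refine Or.inl ⟨⟨rfl, h.1⟩, ?_⟩
        rw [not_lt, ← hrk' j]
        exact h.2
      · subst hji
        refine Or.inr ⟨⟨rfl, h.1⟩, ?_⟩
        rw [← hrko' j]
        exact h.2
    · rintro (⟨⟨hji, hpos⟩, h⟩ | ⟨⟨hji, hneg⟩, h⟩)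
      · subst hji
        refine ⟨Or.inl ⟨hpos, ?_⟩, rfl⟩
        rw [hrk' j, ← not_lt]
        exact h
      · subst hji
        refine ⟨Or.inr ⟨hneg, ?_⟩, rfl⟩
        rw [hrko' j]
        exact h
  -- block `i` of `J`
  have hJB : ∀ i, J.filter (fun j => B j = i) = (P i ∩ J) ∪ (M i ∩ J) := by
    intro i
    ext j
    simp only [Finset.mem_filter, Finset.mem_union, Finset.mem_inter, memP, memM]
    constructor
    · rintro ⟨hj, hji⟩
      rcases lt_or_gt_of_ne (hc j) with h | h
      · exact Or.inr ⟨⟨hji, h⟩, hj⟩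
      · exact Or.inl ⟨⟨hji, h⟩, hj⟩
    · rintro (⟨⟨hji, -⟩, hj⟩ | ⟨⟨hji, -⟩, hj⟩) <;> exact ⟨hj, hji⟩
  have hdisjK : ∀ i, Disjoint
      ((P i).filter fun x => ¬ ((P i).filter fun z => c z < c x ∨ (c z = c x ∧ z < x)).card < b i)
      ((M i).filter fun x => ((M i).filter fun z => -c z < -c x ∨ (-c z = -c x ∧ z < x)).card < a i) :=
    fun i => Finset.disjoint_filter_filter (hPM i)
  have hdisjJ : ∀ i, Disjoint (P i ∩ J) (M i ∩ J) := fun i =>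
    (hPM i).mono Finset.inter_subset_left Finset.inter_subset_left
  -- (4) same block counts as `J`, hence admissible
  have hcardK : ∀ i, (K.filter fun j => B j = i).card = (J.filter fun j => B j = i).card := by
    intro i
    rw [hKB, hJB, Finset.card_union_of_disjoint (hdisjK i), Finset.card_union_of_disjoint (hdisjJ i), hKPcard,
      hUcard]
    have h1 := Finset.card_sdiff_add_card_inter (P i) J
    rw [← hb] at h1
    rw [← ha]
    omega
  have hKadm : ∀ i, (K.filter fun j => B j = i).card % q i = r i % q i := fun i => by rw [hcardK]; exact hJ i
  -- (5) block by block, `J` is worth at most `K`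
  have hsumle : ∀ i, ∑ j ∈ J.filter (fun j => B j = i), c j ≤ ∑ j ∈ K.filter (fun j => B j = i), c j := by
    intro i
    rw [hKB, hJB, Finset.sum_union (hdisjK i), Finset.sum_union (hdisjJ i)]
    apply add_le_add
    · -- positives: `K` omits the `b i` cheapest, `J` omits some `b i` of them
      have h1 := Finset.sum_inter_add_sum_sdiff (P i) J c
      have h2 : ∑ x ∈ (P i).filter (fun x => ((P i).filter fun z => c z < c x ∨ (c z = c x ∧ z < x)).card < b i),
            c x +
          ∑ x ∈ (P i).filter (fun x => ¬ ((P i).filter fun z => c z < c x ∨ (c z = c x ∧ z < x)).card < b i),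
            c x = ∑ x ∈ P i, c x :=
        Finset.sum_filter_add_sum_filter_not _ _ _
      have h3 : ∑ x ∈ (P i).filter (fun x => ((P i).filter fun z => c z < c x ∨ (c z = c x ∧ z < x)).card < b i),
          c x ≤ ∑ x ∈ P i \ J, c x := by
        rw [hb]
        exact sum_filter_rank_lt_le (P i) c Finset.sdiff_subset
      linarith
    · -- negatives: `K` takes the `a i` closest to `0`, `J` takes some `a i` of them
      have h3 : ∑ x ∈ (M i).filter
            (fun x => ((M i).filter fun z => -c z < -c x ∨ (-c z = -c x ∧ z < x)).card < a i), -c x ≤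
          ∑ x ∈ M i ∩ J, -c x := by
        rw [ha]
        exact sum_filter_rank_lt_le (M i) (fun j => -c j) Finset.inter_subset_left
      rw [Finset.sum_neg_distrib, Finset.sum_neg_distrib, neg_le_neg_iff] at h3
      exact h3
  refine ⟨hKadm, le_antisymm (hmax K hKadm) ?_⟩
  rw [← Finset.sum_fiberwise J B c, ← Finset.sum_fiberwise K B c]
  exact Finset.sum_le_sum fun i _ => hsumle i

end ResidueNormalFormAux

/-- **Exchange normal form of a residue-constrained maximiser** (THEOREM G of line `binomial-normal-form`, piece
G3).  With nonzero values `c j`, blocks `B`, moduli `q i ≥ 1` and residues `r i`, every admissible `J` (block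
cardinalities `≡ r i mod q i`) maximising `Σ_{j∈J} c j` has the same value as a CANONICAL admissible set: keep the
positives of each block except its `b i` cheapest (key `(c j, j)`), add the `a i` negatives closest to `0` (key
`(-c j, j)`), with `a i, b i < q i`.  In the statement the in-block rank of a positive `j` is
`#{j' | B j' = B j, 0 < c j', (c j', j') < (c j, j)}` and `j` is kept iff `b (B j) ≤ rank`; the rank of a negative `j`
is `#{j' | B j' = B j, c j' < 0, c j < c j' ∨ (c j' = c j ∧ j' < j)}` and `j` is added iff `rank < a (B j)`.
Proof: `ResidueNormalFormAux.normalForm_of_rank`. [folklore: exchange argument] -/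
theorem stub_residueNormalForm (N s : ℕ) (B : Fin N → Fin s) (q r : Fin s → ℕ) (hq : ∀ i, 1 ≤ q i) (c : Fin N → ℝ)
    (hc : ∀ j, c j ≠ 0) (J : Finset (Fin N))
    (hJ : ∀ i, (J.filter fun j => B j = i).card % q i = r i % q i)
    (hmax : ∀ J' : Finset (Fin N), (∀ i, (J'.filter fun j => B j = i).card % q i = r i % q i) →
      ∑ j ∈ J', c j ≤ ∑ j ∈ J, c j) :
    ∃ a b : Fin s → ℕ, (∀ i, a i < q i ∧ b i < q i) ∧
      (∀ i, ((Finset.univ.filter fun j : Fin N =>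
          (0 < c j ∧ b (B j) ≤ (Finset.univ.filter fun j' : Fin N =>
              B j' = B j ∧ 0 < c j' ∧ (c j' < c j ∨ (c j' = c j ∧ j' < j))).card) ∨
          (c j < 0 ∧ (Finset.univ.filter fun j' : Fin N =>
              B j' = B j ∧ c j' < 0 ∧ (c j < c j' ∨ (c j' = c j ∧ j' < j))).card < a (B j))).filter
            fun j => B j = i).card % q i = r i % q i) ∧
      ∑ j ∈ (Finset.univ.filter fun j : Fin N =>
          (0 < c j ∧ b (B j) ≤ (Finset.univ.filter fun j' : Fin N =>
              B j' = B j ∧ 0 < c j' ∧ (c j' < c j ∨ (c j' = c j ∧ j' < j))).card) ∨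
          (c j < 0 ∧ (Finset.univ.filter fun j' : Fin N =>
              B j' = B j ∧ c j' < 0 ∧ (c j < c j' ∨ (c j' = c j ∧ j' < j))).card < a (B j))), c j =
        ∑ j ∈ J, c j := by
  exact ResidueNormalFormAux.normalForm_of_rank N s B q r hq c hc J hJ hmax
    (fun j => (Finset.univ.filter fun j' : Fin N =>
      B j' = B j ∧ 0 < c j' ∧ (c j' < c j ∨ (c j' = c j ∧ j' < j))).card)
    (fun j => (Finset.univ.filter fun j' : Fin N =>
      B j' = B j ∧ c j' < 0 ∧ (c j < c j' ∨ (c j' = c j ∧ j' < j))).card)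
    (fun j => by
      congr 1
      ext z
      simp only [Finset.mem_filter, Finset.mem_univ, true_and, and_assoc])
    (fun j => by
      congr 1
      ext z
      simp only [Finset.mem_filter, Finset.mem_univ, true_and, and_assoc, neg_lt_neg_iff, neg_inj])

end Summit.ValiantsHypothesis.ValiantsHypothesis.Theorems.NewtonUnitEquationsNewtonTauWeak
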